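import Literature.NumberTheory.EllipticCurves.Kato2004.IwasawaCohomologyNumberFieldResCor
import Literature.NumberTheory.GaloisRepresentations.ContinuousCohomologyConnecting
import HarnessLib

/-!
# Coefficient change on the subgroup model `H¹(V_n, ·)` along a `Gal(ℚ̄/K)`-equivariant isomorphism of Tate modules
# `u : T_pA ≃ T_pW` (e.g. the quadratic twist `A = W^{(d_K)}`), and the model-side lemmas for the TWISTED Shapiro maps

Topic `NumberTheory/EllipticCurves`, sub-directory `Kato2004`; sixth file of the `K`-carrier vocabulary
(`IwasawaCohomologyNumberField{,Restriction,Loc,Corestriction,ResCor}.lean`).  Seat `bsd-2adic-conv-1` GEN 30 (cell `pub/bsd-2adic`).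
HONEST FRAMING: definitions with bodies and proved theorems only; no named fact, no `sorry`; nothing about any curve is asserted;
BSD is not advanced by this file.

For the Shapiro lattice `L = loc_w̄ 𝐇¹_{K,Γ}(T_pW_K)` of the crux-19556 line one needs, besides `res`/`cor` for `W`, the TWISTED
maps for a second curve `A/ℚ` whose Tate module is isomorphic to `T_pW` as a `Gal(ℚ̄/K)`-module (`A = W^K`, the quadratic twist by
`K`; integral twist isomorphism: `WeierstrassCurve.exists_tateModule_equiv_of_smul_eq_quadraticTwist`).  This file is the MODEL-SIDE
plumbing: with `V_n = galRange K ⊓ Γ_{ℚ_n}` (`layerGalRange`) and a continuous `ℤ_p`-linear `u : T_pA ≃ T_pW` equivariant for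
`galRange K` (hypotheses `hu`, `hu₁`; no named object),

* §0 generic: `resLe_mem_integralH1` (restriction to a smaller level preserves the integral classes), `resLe_conjMap`
  (restriction commutes with the conjugation action), `resLe_layerCores_eq_coresLe_resLe` (`res_{V_n/U_n} ∘ Cor_{U_{n+1}/U_n} =
  cor_{V_n/V_{n+1}} ∘ res_{V_{n+1}/U_{n+1}}`, one double coset since `V_n U_{n+1} = U_n`);
* §1 **`layerTwist u n : H¹(V_n, T_pA) → H¹(V_n, T_pW)`** (`cohomologyMap` of the `V_n`-equivariant `u`), its inverse `layerUntwist`,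
  `layerTwist_mem_integralH1` / `layerUntwist_mem_integralH1`, compatibility with `cor_{V_n/V_{n+1}}` (`layerTwist_coresLe`, transport
  lemma `map_coresLe_eq_coresLe_map`) and with conjugation by `g ∈ galRange K` (`layerTwist_conjMap`; for `K/ℚ` Galois) — and, under the
  SIGN hypothesis `hu₂ : u(σx) = −σu(x)` for `σ ∉ galRange K` (quadratic twist), `layerTwist_conjMap_of_not_mem`: `u_* ∘ conj_σ = −conj_σ ∘ u_*`;
* §2 the inverse model map `layerOfGalRange` (file `…ResCor`) preserves integrality (`layerOfGalRange_mem_integralH1K`), commutes with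
  the trace maps (`layerOfGalRange_coresLe`) and is equivariant (`layerOfGalRange_conjMap`).

References: J. Neukirch, A. Schmidt, K. Wingberg, *Cohomology of Number Fields* (2008), I §5 Prop. 1.5.4, (1.5.6)–(1.5.7)
[NeukirchSchmidtWingberg2008]; J.-P. Serre, *Galois Cohomology* (1997) I §2.4–§2.5 [SerreGaloisCohomology1997]; K. Kato, Astérisque 295
(2004) §8.2, §12.2 [Kato2004Asterisque]; J. H. Silverman, *AEC* (2009) X.5 Cor. 5.4 [SilvermanAEC2009].
-/

noncomputable section

open scoped NumberField Pointwise
open CategoryTheory Field IsDedekindDomain Polynomial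
open Literature.NumberTheory.GaloisRepresentations
open Literature.NumberTheory.EllipticCurves (subgroupInclusion subgroupInclusion_apply_coe
  subgroupConj subgroupConj_apply_coe tateModuleEquiv continuous_tateModuleEquiv continuous_tateModuleEquiv_symm
  tateModuleEquiv_tateGaloisRep_restrict galRange rangeToResGal resGal_rangeToResGal resGal rangeToResGal_resGalToRange)
open Literature.NumberTheory.EllipticCurves.Kato2004.CM (tateRepK integralH1K mem_integralH1K_iff)
open Literature.NumberTheory.EllipticCurves.Kato2004.EulerSystemValues (tateRep)

namespace Literature.NumberTheory.EllipticCurves.Kato2004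

universe u v

/-! ## §0 Generic: restriction to a smaller level -/

section Generic

variable {R : Type u} [CommRing R] [TopologicalSpace R]
  {G : Type v} [Group G] [TopologicalSpace G] [IsTopologicalGroup G]

/-- **Restriction commutes with the conjugation action**: for `V ≤ U` both normal in `G` and `g ∈ G`,
`res_{V/U} (g · c) = g · res_{V/U} c` (on cocycles both are `v ↦ g φ(g⁻¹ v g)`). [cite: NeukirchSchmidtWingberg2008, I §5 Prop. 1.5.4] -/
theorem resLe_conjMap (X : TopRep.{v} R G) {V U : Subgroup G} [V.Normal] [U.Normal] (h : V ≤ U) (g : G)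
    (c : continuousCohomology 1 (subgroupRep X U)) :
    resLe X h 1 (conjMap X U g 1 c) = conjMap X V g 1 (resLe X h 1 c) := by
  obtain ⟨φ, rfl⟩ := oneCocycleClass_surjective _ c
  rw [conjMap_oneCocycleClass, resLe_oneCocycleClass, resLe_oneCocycleClass, conjMap_oneCocycleClass]
  refine congrArg _ (Subtype.ext (ContinuousMap.ext fun x ↦ ?_))
  have harg : subgroupInclusion h (subgroupConj V g x) = subgroupConj U g (subgroupInclusion h x) := Subtype.ext rfl
  rw [contOneCocycles.pullback_apply, conj_pullback_apply, conj_pullback_apply, contOneCocycles.pullback_apply, harg]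
  rfl

end Generic

section GenericRat

variable {A : Type} [CommRing A] [TopologicalSpace A] {M : Type} [AddCommGroup M] [Module A M]
  [TopologicalSpace M] [IsTopologicalAddGroup M] [ContinuousSMul A M]

/-- **Restriction to a smaller level preserves the integral classes**: `res_{V/U}` maps `H¹(ℤ_U[1/p], T)` into `H¹(ℤ_V[1/p], T)`
(a coboundary on `U ∩ I_𝔓` is a coboundary on `V ∩ I_𝔓`). [cite: Kato2004Asterisque, §8.2 and Lemma 8.5 (pp. 180–184)] -/
theorem resLe_mem_integralH1 (T : GaloisRep ℚ A M) (p : ℕ) {V U : Subgroup (absoluteGaloisGroup ℚ)} (h : V ≤ U)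
    {x : H1 T U} (hx : x ∈ integralH1 T p U) : resLe T.toTopRep h 1 x ∈ integralH1 T p V := by
  rw [mem_integralH1_iff] at hx ⊢
  intro v hv 𝔓 h𝔓
  obtain ⟨φ, rfl⟩ := oneCocycleClass_surjective _ x
  have h0 := hx v hv 𝔓 h𝔓
  rw [resLe_oneCocycleClass, oneCocycleClass_eq_zero_iff] at h0
  obtain ⟨w, hw⟩ := h0
  rw [resLe_oneCocycleClass, resLe_oneCocycleClass, oneCocycleClass_eq_zero_iff]
  refine ⟨w, fun g ↦ ?_⟩
  have key : φ.1 (subgroupInclusion inf_le_left ⟨(g : absoluteGaloisGroup ℚ), h g.2.1, g.2.2⟩) =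
      T.toTopRep.ρ (g : absoluteGaloisGroup ℚ) w - w := hw ⟨(g : absoluteGaloisGroup ℚ), h g.2.1, g.2.2⟩
  have harg : subgroupInclusion h (subgroupInclusion (inf_le_left : V ⊓ 𝔓.inertia (absoluteGaloisGroup ℚ) ≤ V) g) =
      subgroupInclusion inf_le_left ⟨(g : absoluteGaloisGroup ℚ), h g.2.1, g.2.2⟩ := Subtype.ext rfl
  rw [contOneCocycles.pullback_apply, contOneCocycles.pullback_apply, TopRep.hom_ofHom, TopRep.hom_ofHom, harg]
  exact key

end GenericRat

/-! ## §1 The coefficient change `u_* : H¹(V_n, T_pA) → H¹(V_n, T_pW)` -/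

section Twist

variable (K : Type) [Field K] [NumberField K] {p : ℕ} [Fact p.Prime] (κ : ZpExtension ℚ p)
  (h : Function.Surjective (κ.toContinuousMonoidHom.comp (absGaloisRestrict ℚ K)))
  (W : WeierstrassCurve ℚ) [W.IsElliptic] [ContinuousSMul ℤ_[p] (W.tateModule p)]
  (A' : WeierstrassCurve ℚ) [A'.IsElliptic] [ContinuousSMul ℤ_[p] (A'.tateModule p)]
  (u : A'.tateModule p ≃ₗ[ℤ_[p]] W.tateModule p) (hu : Continuous u) (hu' : Continuous u.symm)
  (hu₁ : ∀ σ : absoluteGaloisGroup ℚ, σ ∈ galRange (K := ℚ) K → ∀ x : A'.tateModule p, u (σ • x) = σ • u x)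

/-- The action of `tateRep` is the Galois action on `T_p` (unfolding). [folklore] -/
private theorem tateRep_ρ_apply (V : WeierstrassCurve ℚ) [V.IsElliptic] [ContinuousSMul ℤ_[p] (V.tateModule p)]
    (σ : absoluteGaloisGroup ℚ) (x : V.tateModule p) : (tateRep V p).toTopRep.ρ σ x = σ • x := rfl

omit [W.IsElliptic] [ContinuousSMul ℤ_[p] (W.tateModule p)] [A'.IsElliptic] [ContinuousSMul ℤ_[p] (A'.tateModule p)] in
include hu₁ in
/-- Equivariance of `u⁻¹` on `galRange K`. [cite: SilvermanAEC2009, X.5 Cor. 5.4] -/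
theorem symm_smul_of_mem {σ : absoluteGaloisGroup ℚ} (hσ : σ ∈ galRange (K := ℚ) K) (y : W.tateModule p) :
    u.symm (σ • y) = σ • u.symm y := by
  apply u.injective
  rw [LinearEquiv.apply_symm_apply, hu₁ σ hσ, LinearEquiv.apply_symm_apply]

/-- The `V_n`-equivariant coefficient map `u : T_pA|_{V_n} ⟶ T_pW|_{V_n}` (`V_n ≤ galRange K`). [cite: SilvermanAEC2009, X.5 Cor. 5.4] -/
def twistRepHom (n : ℕ) :
    subgroupRep (tateRep A' p).toTopRep (layerGalRange K κ n) ⟶ subgroupRep (tateRep W p).toTopRep (layerGalRange K κ n) :=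
  TopRep.ofHom ⟨⟨u.toLinearMap, hu⟩, fun g => ContinuousLinearMap.ext fun x => hu₁ (g : absoluteGaloisGroup ℚ) g.2.1 x⟩

/-- The coefficient map of `twistRepHom` is `u`. [cite: SilvermanAEC2009, X.5 Cor. 5.4] -/
@[simp] theorem twistRepHom_hom_apply (n : ℕ) (x : A'.tateModule p) : (twistRepHom K κ W A' u hu hu₁ n).hom x = u x := rfl

/-- The inverse coefficient map `u⁻¹ : T_pW|_{V_n} ⟶ T_pA|_{V_n}`. [cite: SilvermanAEC2009, X.5 Cor. 5.4] -/
def untwistRepHom (n : ℕ) :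
    subgroupRep (tateRep W p).toTopRep (layerGalRange K κ n) ⟶ subgroupRep (tateRep A' p).toTopRep (layerGalRange K κ n) :=
  TopRep.ofHom ⟨⟨u.symm.toLinearMap, hu'⟩, fun g => ContinuousLinearMap.ext fun y =>
    symm_smul_of_mem K W A' u hu₁ g.2.1 y⟩

/-- The coefficient map of `untwistRepHom` is `u⁻¹`. [cite: SilvermanAEC2009, X.5 Cor. 5.4] -/
@[simp] theorem untwistRepHom_hom_apply (n : ℕ) (y : W.tateModule p) :
    (untwistRepHom K κ W A' u hu' hu₁ n).hom y = u.symm y := rfl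

/-- **`u_* : H¹(V_n, T_pA) → H¹(V_n, T_pW)`**, the coefficient change along `u`. [cite: SerreGaloisCohomology1997, I §2.4] -/
def layerTwist (n : ℕ) : H1 (tateRep A' p) (layerGalRange K κ n) ⟶ H1 (tateRep W p) (layerGalRange K κ n) :=
  cohomologyMap (twistRepHom K κ W A' u hu hu₁ n) 1

/-- **`u⁻¹_* : H¹(V_n, T_pW) → H¹(V_n, T_pA)`**. [cite: SerreGaloisCohomology1997, I §2.4] -/
def layerUntwist (n : ℕ) : H1 (tateRep W p) (layerGalRange K κ n) ⟶ H1 (tateRep A' p) (layerGalRange K κ n) :=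
  cohomologyMap (untwistRepHom K κ W A' u hu' hu₁ n) 1

/-- `u_*` on explicit cocycles: `[φ] ↦ [u ∘ φ]`. [cite: SerreGaloisCohomology1997, I §2.4] -/
theorem layerTwist_oneCocycleClass (n : ℕ) (φ : contOneCocycles (subgroupRep (tateRep A' p).toTopRep (layerGalRange K κ n))) :
    layerTwist K κ W A' u hu hu₁ n (oneCocycleClass _ φ) =
      oneCocycleClass _ (contOneCocycles.pullback (ContinuousMonoidHom.id _) (resIdHom (twistRepHom K κ W A' u hu hu₁ n)) φ) :=
  cohomologyMap_oneCocycleClass _ φ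

/-- `u⁻¹_*` on explicit cocycles: `[ψ] ↦ [u⁻¹ ∘ ψ]`. [cite: SerreGaloisCohomology1997, I §2.4] -/
theorem layerUntwist_oneCocycleClass (n : ℕ) (ψ : contOneCocycles (subgroupRep (tateRep W p).toTopRep (layerGalRange K κ n))) :
    layerUntwist K κ W A' u hu' hu₁ n (oneCocycleClass _ ψ) =
      oneCocycleClass _ (contOneCocycles.pullback (ContinuousMonoidHom.id _) (resIdHom (untwistRepHom K κ W A' u hu' hu₁ n)) ψ) :=
  cohomologyMap_oneCocycleClass _ ψ

/-- `u⁻¹_* ∘ u_* = id`. [cite: SerreGaloisCohomology1997, I §2.4] -/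
@[simp] theorem layerUntwist_layerTwist (n : ℕ) (c : H1 (tateRep A' p) (layerGalRange K κ n)) :
    layerUntwist K κ W A' u hu' hu₁ n (layerTwist K κ W A' u hu hu₁ n c) = c := by
  obtain ⟨φ, rfl⟩ := oneCocycleClass_surjective _ c
  rw [layerTwist_oneCocycleClass, layerUntwist_oneCocycleClass]
  refine congrArg _ (Subtype.ext (ContinuousMap.ext fun g ↦ ?_))
  rw [pullback_id_resIdHom_apply, pullback_id_resIdHom_apply, twistRepHom_hom_apply, untwistRepHom_hom_apply,
    LinearEquiv.symm_apply_apply]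

/-- `u_* ∘ u⁻¹_* = id`. [cite: SerreGaloisCohomology1997, I §2.4] -/
@[simp] theorem layerTwist_layerUntwist (n : ℕ) (c : H1 (tateRep W p) (layerGalRange K κ n)) :
    layerTwist K κ W A' u hu hu₁ n (layerUntwist K κ W A' u hu' hu₁ n c) = c := by
  obtain ⟨ψ, rfl⟩ := oneCocycleClass_surjective _ c
  rw [layerUntwist_oneCocycleClass, layerTwist_oneCocycleClass]
  refine congrArg _ (Subtype.ext (ContinuousMap.ext fun g ↦ ?_))
  rw [pullback_id_resIdHom_apply, pullback_id_resIdHom_apply, twistRepHom_hom_apply, untwistRepHom_hom_apply,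
    LinearEquiv.apply_symm_apply]

/-- **`u_*` preserves the integral classes** `integralH1 · p V_n` (a coboundary `g·w − w` maps to the coboundary of `u w`, `u` being
`V_n`-equivariant). [cite: Kato2004Asterisque, §8.2 and Lemma 8.5 (pp. 180–184)] -/
theorem layerTwist_mem_integralH1 (n : ℕ) {c : H1 (tateRep A' p) (layerGalRange K κ n)}
    (hc : c ∈ integralH1 (tateRep A' p) p (layerGalRange K κ n)) :
    layerTwist K κ W A' u hu hu₁ n c ∈ integralH1 (tateRep W p) p (layerGalRange K κ n) := by
  rw [mem_integralH1_iff] at hc ⊢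
  intro v hv 𝔓 h𝔓
  obtain ⟨φ, rfl⟩ := oneCocycleClass_surjective _ c
  have h0 := hc v hv 𝔓 h𝔓
  rw [resLe_oneCocycleClass, oneCocycleClass_eq_zero_iff] at h0
  obtain ⟨w, hw⟩ := h0
  rw [layerTwist_oneCocycleClass, resLe_oneCocycleClass, oneCocycleClass_eq_zero_iff]
  refine ⟨u w, fun g ↦ ?_⟩
  have key : φ.1 (subgroupInclusion inf_le_left g) = (tateRep A' p).toTopRep.ρ (g : absoluteGaloisGroup ℚ) w - w := hw g
  rw [contOneCocycles.pullback_apply, TopRep.hom_ofHom]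
  change u (φ.1 (subgroupInclusion inf_le_left g)) = (tateRep W p).toTopRep.ρ (g : absoluteGaloisGroup ℚ) (u w) - u w
  rw [key, map_sub, tateRep_ρ_apply, tateRep_ρ_apply, hu₁ _ g.2.1.1]

/-- **`u⁻¹_*` preserves the integral classes.** [cite: Kato2004Asterisque, §8.2 and Lemma 8.5 (pp. 180–184)] -/
theorem layerUntwist_mem_integralH1 (n : ℕ) {c : H1 (tateRep W p) (layerGalRange K κ n)}
    (hc : c ∈ integralH1 (tateRep W p) p (layerGalRange K κ n)) :
    layerUntwist K κ W A' u hu' hu₁ n c ∈ integralH1 (tateRep A' p) p (layerGalRange K κ n) := by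
  rw [mem_integralH1_iff] at hc ⊢
  intro v hv 𝔓 h𝔓
  obtain ⟨ψ, rfl⟩ := oneCocycleClass_surjective _ c
  have h0 := hc v hv 𝔓 h𝔓
  rw [resLe_oneCocycleClass, oneCocycleClass_eq_zero_iff] at h0
  obtain ⟨w, hw⟩ := h0
  rw [layerUntwist_oneCocycleClass, resLe_oneCocycleClass, oneCocycleClass_eq_zero_iff]
  refine ⟨u.symm w, fun g ↦ ?_⟩
  have key : ψ.1 (subgroupInclusion inf_le_left g) = (tateRep W p).toTopRep.ρ (g : absoluteGaloisGroup ℚ) w - w := hw g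
  rw [contOneCocycles.pullback_apply, TopRep.hom_ofHom]
  change u.symm (ψ.1 (subgroupInclusion inf_le_left g)) = (tateRep A' p).toTopRep.ρ (g : absoluteGaloisGroup ℚ) (u.symm w) - u.symm w
  rw [key, map_sub, tateRep_ρ_apply, tateRep_ρ_apply, symm_smul_of_mem K W A' u hu₁ g.2.1.1]

/-- **`u_*` commutes with `cor_{V_n/V_{n+1}}`** (transport of the corestriction along the pair `(id, u)`, `map_coresLe_eq_coresLe_map`).
[cite: NeukirchSchmidtWingberg2008, I §5 Prop. 1.5.4] -/
theorem layerTwist_coresLe (n : ℕ) [Fintype (layerGalRange K κ n ⧸ (layerGalRange K κ (n + 1)).subgroupOf (layerGalRange K κ n))]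
    (c : H1 (tateRep A' p) (layerGalRange K κ (n + 1))) :
    layerTwist K κ W A' u hu hu₁ n
        (coresLe (tateRep A' p).toTopRep (layerGalRange_antitone K κ n) (isOpen_layerGalRange K κ (n + 1)) c) =
      coresLe (tateRep W p).toTopRep (layerGalRange_antitone K κ n) (isOpen_layerGalRange K κ (n + 1))
        (layerTwist K κ W A' u hu hu₁ (n + 1) c) :=
  map_coresLe_eq_coresLe_map (tateRep A' p).toTopRep (tateRep W p).toTopRep
    (layerGalRange_antitone K κ n) (isOpen_layerGalRange K κ (n + 1))
    (layerGalRange_antitone K κ n) (isOpen_layerGalRange K κ (n + 1))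
    (ContinuousMonoidHom.id _) (ContinuousMonoidHom.id _) (fun x ↦ by simp)
    (fun x ↦ by rw [ContinuousMonoidHom.coe_id, id_eq])
    (fun g ↦ ⟨g, by rw [ContinuousMonoidHom.coe_id, id_eq, inv_mul_cancel]; exact Subgroup.one_mem _⟩)
    (resIdHom (twistRepHom K κ W A' u hu hu₁ n)) (resIdHom (twistRepHom K κ W A' u hu hu₁ (n + 1)))
    (fun m ↦ by rw [resIdHom_hom_apply, resIdHom_hom_apply, twistRepHom_hom_apply, twistRepHom_hom_apply]) c

/-- **`u⁻¹_*` commutes with `cor_{V_n/V_{n+1}}`.** [cite: NeukirchSchmidtWingberg2008, I §5 Prop. 1.5.4] -/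
theorem layerUntwist_coresLe (n : ℕ) [Fintype (layerGalRange K κ n ⧸ (layerGalRange K κ (n + 1)).subgroupOf (layerGalRange K κ n))]
    (c : H1 (tateRep W p) (layerGalRange K κ (n + 1))) :
    layerUntwist K κ W A' u hu' hu₁ n
        (coresLe (tateRep W p).toTopRep (layerGalRange_antitone K κ n) (isOpen_layerGalRange K κ (n + 1)) c) =
      coresLe (tateRep A' p).toTopRep (layerGalRange_antitone K κ n) (isOpen_layerGalRange K κ (n + 1))
        (layerUntwist K κ W A' u hu' hu₁ (n + 1) c) :=
  map_coresLe_eq_coresLe_map (tateRep W p).toTopRep (tateRep A' p).toTopRep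
    (layerGalRange_antitone K κ n) (isOpen_layerGalRange K κ (n + 1))
    (layerGalRange_antitone K κ n) (isOpen_layerGalRange K κ (n + 1))
    (ContinuousMonoidHom.id _) (ContinuousMonoidHom.id _) (fun x ↦ by simp)
    (fun x ↦ by rw [ContinuousMonoidHom.coe_id, id_eq])
    (fun g ↦ ⟨g, by rw [ContinuousMonoidHom.coe_id, id_eq, inv_mul_cancel]; exact Subgroup.one_mem _⟩)
    (resIdHom (untwistRepHom K κ W A' u hu' hu₁ n)) (resIdHom (untwistRepHom K κ W A' u hu' hu₁ (n + 1)))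
    (fun m ↦ by rw [resIdHom_hom_apply, resIdHom_hom_apply, untwistRepHom_hom_apply, untwistRepHom_hom_apply]) c

/-- **`u_*` commutes with conjugation by `g ∈ galRange K`** (for `K/ℚ` Galois, so that `g` acts on `H¹(V_n, ·)`): `u_* (g · c) = g · u_* c`.
[cite: NeukirchSchmidtWingberg2008, I §5 Prop. 1.5.4] -/
theorem layerTwist_conjMap [(galRange (K := ℚ) K).Normal] (n : ℕ) {g : absoluteGaloisGroup ℚ} (hg : g ∈ galRange (K := ℚ) K)
    (c : H1 (tateRep A' p) (layerGalRange K κ n)) :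
    layerTwist K κ W A' u hu hu₁ n (haveI := normal_layerGalRange K κ n; conjMap (tateRep A' p).toTopRep (layerGalRange K κ n) g 1 c) =
      (haveI := normal_layerGalRange K κ n; conjMap (tateRep W p).toTopRep (layerGalRange K κ n) g 1 (layerTwist K κ W A' u hu hu₁ n c)) := by
  haveI := normal_layerGalRange K κ n
  obtain ⟨φ, rfl⟩ := oneCocycleClass_surjective _ c
  rw [conjMap_oneCocycleClass, layerTwist_oneCocycleClass, layerTwist_oneCocycleClass, conjMap_oneCocycleClass]
  refine congrArg _ (Subtype.ext (ContinuousMap.ext fun x ↦ ?_))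
  rw [pullback_id_resIdHom_apply, conj_pullback_apply, conj_pullback_apply, pullback_id_resIdHom_apply,
    twistRepHom_hom_apply, twistRepHom_hom_apply]
  exact hu₁ g hg _

/-- **`u⁻¹_*` commutes with conjugation by `g ∈ galRange K`.** [cite: NeukirchSchmidtWingberg2008, I §5 Prop. 1.5.4] -/
theorem layerUntwist_conjMap [(galRange (K := ℚ) K).Normal] (n : ℕ) {g : absoluteGaloisGroup ℚ} (hg : g ∈ galRange (K := ℚ) K)
    (c : H1 (tateRep W p) (layerGalRange K κ n)) :
    layerUntwist K κ W A' u hu' hu₁ n (haveI := normal_layerGalRange K κ n; conjMap (tateRep W p).toTopRep (layerGalRange K κ n) g 1 c) =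
      (haveI := normal_layerGalRange K κ n; conjMap (tateRep A' p).toTopRep (layerGalRange K κ n) g 1 (layerUntwist K κ W A' u hu' hu₁ n c)) := by
  haveI := normal_layerGalRange K κ n
  obtain ⟨ψ, rfl⟩ := oneCocycleClass_surjective _ c
  rw [conjMap_oneCocycleClass, layerUntwist_oneCocycleClass, layerUntwist_oneCocycleClass, conjMap_oneCocycleClass]
  refine congrArg _ (Subtype.ext (ContinuousMap.ext fun x ↦ ?_))
  rw [pullback_id_resIdHom_apply, conj_pullback_apply, conj_pullback_apply, pullback_id_resIdHom_apply,
    untwistRepHom_hom_apply, untwistRepHom_hom_apply]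
  exact symm_smul_of_mem K W A' u hu₁ hg _

/-- **The SIGN**: for `σ ∉ galRange K` with `u(σx) = −σu(x)` (the quadratic-twist isomorphism `T_p(W^K) ≃ T_pW`), `u_* (σ · c) = −σ · u_* c`
on `H¹(V_n, ·)` (for `K/ℚ` Galois). [cite: SilvermanAEC2009, X.5 Cor. 5.4] -/
theorem layerTwist_conjMap_of_not_mem [(galRange (K := ℚ) K).Normal]
    (hu₂ : ∀ σ : absoluteGaloisGroup ℚ, σ ∉ galRange (K := ℚ) K → ∀ x : A'.tateModule p, u (σ • x) = -(σ • u x))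
    (n : ℕ) {σ : absoluteGaloisGroup ℚ} (hσ : σ ∉ galRange (K := ℚ) K) (c : H1 (tateRep A' p) (layerGalRange K κ n)) :
    layerTwist K κ W A' u hu hu₁ n (haveI := normal_layerGalRange K κ n; conjMap (tateRep A' p).toTopRep (layerGalRange K κ n) σ 1 c) =
      -(haveI := normal_layerGalRange K κ n; conjMap (tateRep W p).toTopRep (layerGalRange K κ n) σ 1 (layerTwist K κ W A' u hu hu₁ n c)) := by
  haveI := normal_layerGalRange K κ n
  obtain ⟨φ, rfl⟩ := oneCocycleClass_surjective _ c
  rw [conjMap_oneCocycleClass, layerTwist_oneCocycleClass, layerTwist_oneCocycleClass, conjMap_oneCocycleClass]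
  simp only [← oneCocycleClassₗ_apply, ← map_neg]
  congr 1
  refine Subtype.ext (ContinuousMap.ext fun x ↦ ?_)
  rw [pullback_id_resIdHom_apply, conj_pullback_apply, Submodule.coe_neg, ContinuousMap.neg_apply, conj_pullback_apply,
    pullback_id_resIdHom_apply, twistRepHom_hom_apply, twistRepHom_hom_apply]
  exact hu₂ σ hσ _

end Twist

/-! ## §2 The inverse model map `layerOfGalRange`: integrality, trace maps, equivariance -/

section OfGalRange

variable (K : Type) [Field K] [NumberField K] {p : ℕ} [Fact p.Prime] (κ : ZpExtension ℚ p)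
  (h : Function.Surjective (κ.toContinuousMonoidHom.comp (absGaloisRestrict ℚ K)))
  (W : WeierstrassCurve ℚ) [W.IsElliptic] [ContinuousSMul ℤ_[p] (W.tateModule p)]
  [ContinuousSMul ℤ_[p] ((W.baseChange K).tateModule p)]

/-- **The inverse model map preserves integrality**: `integralH1 T_pW p V_n → H¹(O_{K_n}[1/p], T_pW_K)` — for a prime `𝔔` of `\bar ℤ_K`
over `w ∤ p`, `res(Γ_{K_n} ∩ I_𝔔) ≤ V_n ∩ I_{𝔔 ∩ \bar ℤ}` (`absGaloisRestrict_mem_inertia_comap`) and `𝔔 ∩ \bar ℤ` lies over a rational prime `≠ p`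
(verbatim the argument of `layerResOver_mem_integralH1K`). [cite: Kato2004Asterisque, §8.2 and Lemma 8.5 (pp. 180–184)] -/
theorem layerOfGalRange_mem_integralH1K (n : ℕ) {c : H1 (tateRep W p) (layerGalRange K κ n)}
    (hc : c ∈ integralH1 (tateRep W p) p (layerGalRange K κ n)) :
    layerOfGalRange K κ h W n c ∈ integralH1K (tateRepK (W.baseChange K) p) p ((κ.restrict K h).layerSubgroup n) := by
  rw [mem_integralH1K_iff]
  intro w hw 𝔔 h𝔔
  obtain ⟨ψ, rfl⟩ := oneCocycleClass_surjective _ c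
  haveI := h𝔔.1
  have h𝔓 : 𝔔.comap (absIntegersMap ℚ K) ∈ (HeightOneSpectrum.under (𝓞 ℚ) w).primesAbove :=
    comap_absIntegersMap_mem_primesAbove (K := ℚ) (M := K) (HeightOneSpectrum.under_asIdeal (𝓞 ℚ) w).symm h𝔔
  have h0 := (mem_integralH1_iff _ _ _ _).mp hc _ (primesEquiv_under_ne (p := p) hw) _ h𝔓
  rw [resLe_oneCocycleClass, oneCocycleClass_eq_zero_iff] at h0
  obtain ⟨b, hb⟩ := h0
  rw [layerOfGalRange_oneCocycleClass, resLe_oneCocycleClass, oneCocycleClass_eq_zero_iff]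
  refine ⟨tateModuleEquiv W K p b, fun σ ↦ ?_⟩
  have hσU : (σ : absoluteGaloisGroup K) ∈ (κ.restrict K h).layerSubgroup n := σ.2.1
  have hσV : absGaloisRestrict ℚ K (σ : absoluteGaloisGroup K) ∈ layerGalRange K κ n :=
    ⟨⟨(σ : absoluteGaloisGroup K), rfl⟩, (mem_layerSubgroup_restrict_iff κ h n _).mp hσU⟩
  have hσI : absGaloisRestrict ℚ K (σ : absoluteGaloisGroup K) ∈ (𝔔.comap (absIntegersMap ℚ K)).inertia (absoluteGaloisGroup ℚ) :=
    absGaloisRestrict_mem_inertia_comap ℚ K σ.2.2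
  have key : ψ.1 (subgroupInclusion inf_le_left ⟨absGaloisRestrict ℚ K (σ : absoluteGaloisGroup K), hσV, hσI⟩) =
      (tateRep W p).toTopRep.ρ (absGaloisRestrict ℚ K (σ : absoluteGaloisGroup K)) b - b :=
    hb ⟨absGaloisRestrict ℚ K (σ : absoluteGaloisGroup K), hσV, hσI⟩
  have harg : layerResHomToGalRange K κ h n (subgroupInclusion (inf_le_left : (κ.restrict K h).layerSubgroup n ⊓
        𝔔.inertia (absoluteGaloisGroup K) ≤ (κ.restrict K h).layerSubgroup n) σ) =
      subgroupInclusion inf_le_left ⟨absGaloisRestrict ℚ K (σ : absoluteGaloisGroup K), hσV, hσI⟩ := Subtype.ext rfl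
  rw [contOneCocycles.pullback_apply, TopRep.hom_ofHom]
  change (contOneCocycles.pullback (layerResHomToGalRange K κ h n) (layerOfGalRangeRepHom K κ h W n) ψ).1
      (subgroupInclusion (inf_le_left : (κ.restrict K h).layerSubgroup n ⊓
        𝔔.inertia (absoluteGaloisGroup K) ≤ (κ.restrict K h).layerSubgroup n) σ) = _
  rw [contOneCocycles.pullback_apply, harg, key, layerOfGalRangeRepHom_hom_apply, map_sub, subgroupRep_ρ_apply,
    tateModuleEquiv_toTopRep_ρ]

/-- `layerResHomToGalRange (n+1)` and `layerResHomToGalRange n` agree on `Γ_{K_{n+1}}` (one-sided unfolding). [folklore] -/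
private theorem layerResHomToGalRange_succ_coe (n : ℕ) (x : (κ.restrict K h).layerSubgroup (n + 1)) :
    ((layerResHomToGalRange K κ h (n + 1) x : layerGalRange K κ (n + 1)) : absoluteGaloisGroup ℚ) =
      ((layerResHomToGalRange K κ h n ⟨x, (κ.restrict K h).layerSubgroup_antitone (Nat.le_succ n) x.2⟩ : layerGalRange K κ n) :
        absoluteGaloisGroup ℚ) := by
  rw [layerResHomToGalRange_apply_coe, layerResHomToGalRange_apply_coe]

/-- **The inverse model map commutes with the trace maps**: `layerOfGalRange n ∘ cor_{V_n/V_{n+1}} = Cor_{K_{n+1}/K_n} ∘ layerOfGalRange (n+1)`.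
[cite: NeukirchSchmidtWingberg2008, I §5 Prop. 1.5.4 and (1.5.6)] -/
theorem layerOfGalRange_coresLe (n : ℕ) [Fintype (layerGalRange K κ n ⧸ (layerGalRange K κ (n + 1)).subgroupOf (layerGalRange K κ n))]
    (c : H1 (tateRep W p) (layerGalRange K κ (n + 1))) :
    layerOfGalRange K κ h W n (coresLe (tateRep W p).toTopRep (layerGalRange_antitone K κ n) (isOpen_layerGalRange K κ (n + 1)) c) =
      layerCoresOver (tateRepK (W.baseChange K) p) (κ.restrict K h) n (layerOfGalRange K κ h W (n + 1) c) := by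
  haveI : CompactSpace (absoluteGaloisGroup K) := absoluteGaloisGroup_compactSpace K
  haveI hfiK : ((κ.restrict K h).layerSubgroup (n + 1)).FiniteIndex :=
    finiteIndex_of_isOpen_of_compactSpace _ ((κ.restrict K h).isOpen_layerSubgroup (n + 1))
  letI i2 : Fintype ((κ.restrict K h).layerSubgroup n ⧸
      ((κ.restrict K h).layerSubgroup (n + 1)).subgroupOf ((κ.restrict K h).layerSubgroup n)) := Fintype.ofFinite _
  have hcos : ∀ g : layerGalRange K κ n, ∃ g' : (κ.restrict K h).layerSubgroup n,
      (layerResHomToGalRange K κ h n g')⁻¹ * g ∈ (layerGalRange K κ (n + 1)).subgroupOf (layerGalRange K κ n) := fun g ↦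
    ⟨layerCorHom K κ h n g, by rw [layerResHomToGalRange_layerCorHom, inv_mul_cancel]; exact Subgroup.one_mem _⟩
  rw [layerCoresOver_eq_coresLe (tateRepK (W.baseChange K) p) (κ.restrict K h) n]
  exact map_coresLe_eq_coresLe_map (tateRep W p).toTopRep (tateRepK (W.baseChange K) p).toTopRep
    (layerGalRange_antitone K κ n) (isOpen_layerGalRange K κ (n + 1))
    ((κ.restrict K h).layerSubgroup_antitone (Nat.le_succ n)) ((κ.restrict K h).isOpen_layerSubgroup (n + 1))
    (layerResHomToGalRange K κ h n) (layerResHomToGalRange K κ h (n + 1)) (layerResHomToGalRange_succ_coe K κ h n)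
    (fun x ↦ by
      rw [layerResHomToGalRange_apply_coe, mem_layerGalRange_iff, mem_layerSubgroup_restrict_iff]
      exact ⟨fun hx ↦ hx.2, fun hx ↦ ⟨⟨(x : absoluteGaloisGroup K), rfl⟩, hx⟩⟩) hcos
    (layerOfGalRangeRepHom K κ h W n) (layerOfGalRangeRepHom K κ h W (n + 1))
    (fun m ↦ by rw [layerOfGalRangeRepHom_hom_apply, layerOfGalRangeRepHom_hom_apply]) c

/-- **The inverse model map is equivariant** (for `K/ℚ` Galois): `layerOfGalRange n (res g · c) = g · layerOfGalRange n c`, `g ∈ Γ_K`.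
[cite: NeukirchSchmidtWingberg2008, I §5 Prop. 1.5.4] -/
theorem layerOfGalRange_conjMap [(galRange (K := ℚ) K).Normal] (n : ℕ) (g : absoluteGaloisGroup K)
    (c : H1 (tateRep W p) (layerGalRange K κ n)) :
    layerOfGalRange K κ h W n (haveI := normal_layerGalRange K κ n;
        conjMap (tateRep W p).toTopRep (layerGalRange K κ n) (absGaloisRestrict ℚ K g) 1 c) =
      conjMap (tateRepK (W.baseChange K) p).toTopRep ((κ.restrict K h).layerSubgroup n) g 1 (layerOfGalRange K κ h W n c) := by
  haveI := normal_layerGalRange K κ n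
  obtain ⟨ψ, rfl⟩ := oneCocycleClass_surjective _ c
  rw [conjMap_oneCocycleClass, layerOfGalRange_oneCocycleClass, layerOfGalRange_oneCocycleClass, conjMap_oneCocycleClass]
  refine congrArg _ (Subtype.ext (ContinuousMap.ext fun x ↦ ?_))
  have harg : layerResHomToGalRange K κ h n (subgroupConj ((κ.restrict K h).layerSubgroup n) g x) =
      subgroupConj (layerGalRange K κ n) (absGaloisRestrict ℚ K g) (layerResHomToGalRange K κ h n x) :=
    Subtype.ext (by simp [subgroupConj_apply_coe, layerResHomToGalRange_apply_coe, map_mul, map_inv])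
  rw [contOneCocycles.pullback_apply, conj_pullback_apply, conj_pullback_apply, contOneCocycles.pullback_apply, harg,
    layerOfGalRangeRepHom_hom_apply, layerOfGalRangeRepHom_hom_apply]
  exact tateModuleEquiv_toTopRep_ρ W g _

include h in
/-- The coset condition for `V_n ≤ U_n` against `U_{n+1}`: every `g ∈ Γ_{ℚ_n}` is `v · u` with `v ∈ V_n`, `u ∈ Γ_{ℚ_{n+1}}` (indeed `u ∈ ker κ`),
because `κ ∘ res` is onto (`K ∩ ℚ_∞ = ℚ`). [cite: Washington1997, §13.1] -/
theorem exists_layerGalRange_inv_mul_mem (n : ℕ) (g : κ.layerSubgroup n) :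
    ∃ g' : layerGalRange K κ n,
      ((subgroupInclusion (layerGalRange_le K κ n) g' : κ.layerSubgroup n) : absoluteGaloisGroup ℚ)⁻¹ * (g : absoluteGaloisGroup ℚ) ∈
        κ.layerSubgroup (n + 1) := by
  obtain ⟨τ, hτ⟩ := h (κ (g : absoluteGaloisGroup ℚ))
  have hτ' : κ (absGaloisRestrict ℚ K τ) = κ (g : absoluteGaloisGroup ℚ) := hτ
  have hτn : absGaloisRestrict ℚ K τ ∈ κ.layerSubgroup n := by
    rw [ZpExtension.mem_layerSubgroup, hτ']
    exact ZpExtension.mem_layerSubgroup.mp g.2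
  refine ⟨⟨absGaloisRestrict ℚ K τ, ⟨τ, rfl⟩, hτn⟩, ?_⟩
  apply κ.kerSubgroup_le_layerSubgroup (n + 1)
  rw [subgroupInclusion_apply_coe, ZpExtension.mem_kerSubgroup, map_mul, map_inv, hτ', inv_mul_cancel]

include h in
/-- **`res_{V_n/U_n} ∘ Cor_{ℚ_{n+1}/ℚ_n} = cor_{V_n/V_{n+1}} ∘ res_{V_{n+1}/U_{n+1}}`** on `H¹(ℚ_{n+1}, T)` (one double coset: `V_n · Γ_{ℚ_{n+1}} = Γ_{ℚ_n}` when
`κ ∘ res` is onto, and `V_n ∩ Γ_{ℚ_{n+1}} = V_{n+1}`; transport lemma `map_coresLe_eq_coresLe_map` along the inclusions).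
[cite: NeukirchSchmidtWingberg2008, I §5 (1.5.6)–(1.5.7)] -/
theorem resLe_layerCores_eq_coresLe_resLe (V : WeierstrassCurve ℚ) [V.IsElliptic] [ContinuousSMul ℤ_[p] (V.tateModule p)] (n : ℕ)
    [Fintype (layerGalRange K κ n ⧸ (layerGalRange K κ (n + 1)).subgroupOf (layerGalRange K κ n))]
    (y : H1 (tateRep V p) (κ.layerSubgroup (n + 1))) :
    resLe (tateRep V p).toTopRep (layerGalRange_le K κ n) 1 (layerCores (tateRep V p) κ n y) =
      coresLe (tateRep V p).toTopRep (layerGalRange_antitone K κ n) (isOpen_layerGalRange K κ (n + 1))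
        (resLe (tateRep V p).toTopRep (layerGalRange_le K κ (n + 1)) 1 y) := by
  haveI hfi : (κ.layerSubgroup (n + 1)).FiniteIndex := finiteIndex_of_isOpen_of_compactSpace _ (κ.isOpen_layerSubgroup (n + 1))
  letI i1 : Fintype (κ.layerSubgroup n ⧸ (κ.layerSubgroup (n + 1)).subgroupOf (κ.layerSubgroup n)) := Fintype.ofFinite _
  have hcos : ∀ g : κ.layerSubgroup n, ∃ g' : layerGalRange K κ n,
      (subgroupInclusion (layerGalRange_le K κ n) g')⁻¹ * g ∈ (κ.layerSubgroup (n + 1)).subgroupOf (κ.layerSubgroup n) := fun g ↦ by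
    obtain ⟨g', hg'⟩ := exists_layerGalRange_inv_mul_mem K κ h n g
    exact ⟨g', Subgroup.mem_subgroupOf.mpr hg'⟩
  rw [layerCores_eq_coresLe (tateRep V p) κ n]
  exact map_coresLe_eq_coresLe_map (tateRep V p).toTopRep (tateRep V p).toTopRep
    (κ.layerSubgroup_antitone (Nat.le_succ n)) (κ.isOpen_layerSubgroup (n + 1))
    (layerGalRange_antitone K κ n) (isOpen_layerGalRange K κ (n + 1))
    (subgroupInclusion (layerGalRange_le K κ n)) (subgroupInclusion (layerGalRange_le K κ (n + 1)))
    (fun x ↦ by rw [subgroupInclusion_apply_coe, subgroupInclusion_apply_coe])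
    (fun x ↦ by rw [subgroupInclusion_apply_coe]; exact ⟨fun hx ↦ ⟨x.2.1, hx⟩, fun hx ↦ hx.2⟩) hcos
    (TopRep.ofHom ⟨ContinuousLinearMap.id ℤ_[p] _, fun _ => rfl⟩) (TopRep.ofHom ⟨ContinuousLinearMap.id ℤ_[p] _, fun _ => rfl⟩)
    (fun m ↦ by rw [TopRep.hom_ofHom, TopRep.hom_ofHom]; rfl) y

end OfGalRange

end Literature.NumberTheory.EllipticCurves.Kato2004

end
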